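import Literature.NumberTheory.LFunctions.Zhang2022.RepairCrossFormSection10H2PiecesB
import Literature.NumberTheory.LFunctions.Zhang2022.RepairCrossFormSection10H1

/-!
# K-S3 faithfulness, `H₂`-blocks: formula I on `(J₂, H₂)` IS the transcribed `d′₅ⱼ + d₅ⱼ`, `d′₆ⱼ + d₆ⱼ` on the face `ν₂ = ½`

Trunk T-ANT (NumberTheory/LFunctions). Repair rung F-S1R (D-0077) for Y. Zhang, *Discrete mean estimates and
the Landau–Siegel zero*, arXiv:2211.02515v1 [Zhang2022LandauSiegel] — **an unrefereed manuscript under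
adjudication; nothing here asserts any of its claims.** Assembly of `RepairCrossFormSection10H2Pieces(B)` by
linearity in the two components of `H₂ = ῑ₃H₁₃ + ῑ₄H₁₂` (`h2Profile θ = ῑ₄ϰ_{ν₂,k₂} + ῑ₃ϰ_{ν₃,k₃}`):

* `integral_dipoleIntegrand_rtent_h2 : ∫₀¹ (f₂′+iπjf₂)·conj(tail g₂) = π·(d5pT + d5T + d5xT) θ j`,
* `integral_dipoleIntegrand_h2_rtent : ∫₀¹ (g₂′+iπjg₂)·conj(tail f₂) = π·(d6pT + d6T + d6cT + d6xT) θ j`,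

for admissible designs ON THE FACE `ν₂ = 1/2` of the class (`AdmissibleTheta` has `ν₂ ≤ 1/2`; the transcribed
shapes of (10.14)–(10.16) put `H₁₂`'s profile on ALL of `J₂ = [1−ν₁, 1−ν₂]`, which is the case iff `ν₂ ≥ hi₂ = 1−ν₂`;
off the face the functional of record `dSum2S` is still `P(R̃g₂, f)` (`RepairCrossFormDictionary`) but the literal
transcription under-clips). Consequences: **`dSum2S_eq_section10`**, **`dSumS_eq_section10 : dSumS θ = dprimeT θ +
dfrakT θ`** (with `RepairCrossFormSection10H1.dSum1S_eq_section10`), and the regression at the printed design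
**`dSumS_theta0 : dSumS theta0 = dprime + dfrak`** (`RepairSection10Theta.dprimeT_theta0`, `dfrakT_theta0`) — the
cross slot of the structural barrier at `θ₀` is the tree's certified `𝔡′ + 𝔡` (`Section10Certificate`).

Pure calculus; no new `Prop` facts, no statement about Theorems 1–2.
-/

noncomputable section

open Complex Real ComplexConjugate MeasureTheory Set intervalIntegral
open scoped Interval

namespace Literature.NumberTheory.LFunctions.Zhang2022

namespace Repair

variable {θ : Theta}

/-- continuity of the `𝔣𝔣`-profiles (local copy for `fun_prop`). [cite: Zhang2022LandauSiegel, (8.13)–(8.18)] -/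
@[fun_prop] private theorem ffT_cont'' (k : ℝ) (j : ℕ) : Continuous (ffT k j) := by unfold ffT ffR; fun_prop
/-- continuity of the `𝔤𝔥`-profiles. [cite: Zhang2022LandauSiegel, (8.13)–(8.18)] -/
@[fun_prop] private theorem ghT_cont'' (k : ℝ) (j : ℕ) : Continuous (ghT k j) := by unfold ghT ghR; fun_prop

/-- bounds extracted from the class on the face `ν₂ = 1/2`. [cite: Zhang2022LandauSiegel, §2 (2.21)–(2.28)] -/
private theorem AdmissibleTheta.h2_bounds (h : AdmissibleTheta θ) :
    0 < θ.nu3 ∧ θ.nu3 < θ.nu2 ∧ θ.nu2 < θ.nu1 ∧ θ.nu1 < 1 ∧ 1 - θ.nu1 < θ.nu3 ∧ θ.nu2 ≤ 1 / 2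
      ∧ θ.k2 ≠ 0 ∧ θ.k3 ≠ 0 := by
  obtain ⟨⟨h32, h21⟩, ⟨-, h2h, -⟩, h1, h13, -, ⟨-, ⟨hk2, -⟩, ⟨hk3, -⟩⟩, -⟩ := h
  unfold Theta.belowP at h1
  unfold Theta.dualRangesNonempty at h13
  exact ⟨by linarith, h32, h21, h1, by linarith, h2h, hk2.ne', hk3.ne'⟩

/-- `g₁ = L₆` on the class (the `H₁₃`-window's upper clip is its natural end `ν₃ − lo₂`).
[cite: Zhang2022LandauSiegel, §10 p.56, (10.15)] -/
theorem Theta.g1_eq_L6 (h21 : θ.nu2 < θ.nu1) (h3lo : 1 - θ.nu1 < θ.nu3) : θ.g1 = θ.L6 := by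
  obtain ⟨hml, -⟩ := θ.mid2_eq
  have hp := θ.hw_pos h21
  unfold Theta.g1 Theta.g0 Theta.L6
  refine max_eq_right (max_le (by linarith) (by rw [hml]; linarith))

/-! ### Splitting `H₂` into its two components -/

/-- `(f₂, g₂)`-integrand = `ι₄·(f₂, ϰ₂) + ι₃·(f₂, ϰ₃)` on `[0,1]` (the tail functional is conjugate-linear).
[cite: Zhang2022LandauSiegel, §10 (10.1), (10.14)] -/
theorem dip_rtent_h2_split (h : AdmissibleTheta θ) (j : ℕ) {y : ℝ} (hy0 : 0 ≤ y) (hy1 : y ≤ 1) (f f' : ℝ → ℂ) :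
    dipoleIntegrand j f f' (h2Profile θ) (h2Profile' θ) y
      = θ.iota4 * dipoleIntegrand j f f' (kappaP θ.nu2 θ.k2) (kappaP' θ.nu2 θ.k2) y
        + θ.iota3 * dipoleIntegrand j f f' (kappaP θ.nu3 θ.k3) (kappaP' θ.nu3 θ.k3) y := by
  obtain ⟨h3, h32, h21, h1, -, -, -, -⟩ := h.h2_bounds
  have h2 : 0 < θ.nu2 := h3.trans h32
  have i2 : IntervalIntegrable (kappaP θ.nu2 θ.k2) volume y 1 :=
    ((kinkedProfile_kappaP (k := θ.k2) h2 (by linarith)).cont.mono (Icc_subset_Icc hy0 le_rfl)).intervalIntegrable_of_Icc hy1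
  have i3 : IntervalIntegrable (kappaP θ.nu3 θ.k3) volume y 1 :=
    ((kinkedProfile_kappaP (k := θ.k3) h3 (by linarith)).cont.mono (Icc_subset_Icc hy0 le_rfl)).intervalIntegrable_of_Icc hy1
  have hint : (∫ t in y..1, h2Profile θ t) = conj θ.iota4 * (∫ t in y..1, kappaP θ.nu2 θ.k2 t)
      + conj θ.iota3 * ∫ t in y..1, kappaP θ.nu3 θ.k3 t := by
    unfold h2Profile pairProfile
    rw [intervalIntegral.integral_add (i2.const_mul _) (i3.const_mul _), intervalIntegral.integral_const_mul,
      intervalIntegral.integral_const_mul]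
  unfold dipoleIntegrand
  rw [hint]
  unfold h2Profile h2Profile' pairProfile pairProfile'
  simp only [map_add, map_mul, Complex.conj_conj]
  ring

/-- `(g₂, f₂)`-integrand = `ῑ₄·(ϰ₂, f₂) + ῑ₃·(ϰ₃, f₂)` (the `m`-side is linear). [cite: Zhang2022LandauSiegel, §10 (10.1), (10.16)] -/
theorem dip_h2_rtent_split (θ : Theta) (j : ℕ) (y : ℝ) (f f' : ℝ → ℂ) :
    dipoleIntegrand j (h2Profile θ) (h2Profile' θ) f f' y
      = conj θ.iota4 * dipoleIntegrand j (kappaP θ.nu2 θ.k2) (kappaP' θ.nu2 θ.k2) f f' y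
        + conj θ.iota3 * dipoleIntegrand j (kappaP θ.nu3 θ.k3) (kappaP' θ.nu3 θ.k3) f f' y := by
  unfold dipoleIntegrand h2Profile h2Profile' pairProfile pairProfile'
  ring

/-! ### `∫₀¹ dipoleIntegrand j f₂ f₂′ g₂ g₂′ = π·(d′₅ⱼ + d₅ⱼ + d₅ˣⱼ)(θ)` on the face -/

/-- **formula I on `(J₂, H̄₂)` is the manuscript's `d′₅ⱼ + d₅ⱼ`** (display before (10.14), generic design on the
face `ν₂ = 1/2`, plus the position-of-`ν₃` piece `d5xT`, empty in print).
[cite: Zhang2022LandauSiegel, §10 before (10.14) p.56] -/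
theorem integral_dipoleIntegrand_rtent_h2 (h : AdmissibleTheta θ) (hface : θ.nu2 = 1 / 2) (j : ℕ) :
    ∫ y in (0:ℝ)..1, dipoleIntegrand j (tentT θ.reflectJ) (tentT' θ.reflectJ) (h2Profile θ) (h2Profile' θ) y
      = (π : ℂ) * (d5pT θ j + d5T θ j + d5xT θ j) := by
  obtain ⟨h3, h32, h21, h1, h3lo, -, hk2, hk3⟩ := h.h2_bounds
  have h2 : 0 < θ.nu2 := h3.trans h32
  have hr := reflectJ_lt h21
  have hσ := θ.sig_pos h21
  have hkf := kinkedProfile_tentT hr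
  have I2 := intervalIntegrable_dipoleIntegrand hkf (kinkedProfile_kappaP (k := θ.k2) h2 (by linarith)) j
  have I3 := intervalIntegrable_dipoleIntegrand hkf (kinkedProfile_kappaP (k := θ.k3) h3 (by linarith)) j
  have hsplit : ∫ y in (0:ℝ)..1, dipoleIntegrand j (tentT θ.reflectJ) (tentT' θ.reflectJ) (h2Profile θ) (h2Profile' θ) y
      = θ.iota4 * (∫ y in (0:ℝ)..1, dipoleIntegrand j (tentT θ.reflectJ) (tentT' θ.reflectJ)
          (kappaP θ.nu2 θ.k2) (kappaP' θ.nu2 θ.k2) y)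
        + θ.iota3 * ∫ y in (0:ℝ)..1, dipoleIntegrand j (tentT θ.reflectJ) (tentT' θ.reflectJ)
          (kappaP θ.nu3 θ.k3) (kappaP' θ.nu3 θ.k3) y := by
    rw [← intervalIntegral.integral_const_mul, ← intervalIntegral.integral_const_mul,
      ← intervalIntegral.integral_add (I2.const_mul _) (I3.const_mul _)]
    refine intervalIntegral.integral_congr_uIoo fun y hy => ?_
    rw [uIoo_of_le zero_le_one] at hy
    exact dip_rtent_h2_split h j hy.1.le hy.2.le _ _
  have T1 := integral_dip_rtent_kappa_full (k := θ.k2) h21 h1.le h2 (by linarith) (by linarith) hk2 j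
  have T2 := integral_dip_rtent_kappa_part (by linarith) h21 h1.le h3 h3lo (by linarith) (by linarith) hk3 j
  have he2 : θ.nu2 - (1 - θ.nu2) = θ.e2 := by unfold Theta.e2; ring
  simp only [he2] at T1
  rw [hsplit, T1, T2]
  obtain ⟨-, -, cx3, -⟩ := θ.clip_eqs h21 h3lo.le (by linarith)
  -- split the combined integrals of the transcription
  have iA : IntervalIntegrable (fun z => ghT θ.k2 j (θ.e2 + z)) volume 0 θ.hw := Continuous.intervalIntegrable (by fun_prop) _ _
  have iB : IntervalIntegrable (fun z => ghT θ.k2 j (θ.e2 + θ.hw + z)) volume 0 θ.hw :=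
    Continuous.intervalIntegrable (by fun_prop) _ _
  have iC : IntervalIntegrable (fun z => (((θ.hw - z : ℝ)) : ℂ) * ghT θ.k2 j (θ.e2 + θ.hw + z)) volume 0 θ.hw :=
    Continuous.intervalIntegrable (by fun_prop) _ _
  have iD : IntervalIntegrable (fun z => (z : ℂ) * ghT θ.k2 j (θ.e2 + z)) volume 0 θ.hw :=
    Continuous.intervalIntegrable (by fun_prop) _ _
  have d1 : (∫ z in (0:ℝ)..θ.hw, (ghT θ.k2 j (θ.e2 + z) - ghT θ.k2 j (θ.e2 + θ.hw + z)))
      = (∫ z in (0:ℝ)..θ.hw, ghT θ.k2 j (θ.e2 + z)) - ∫ z in (0:ℝ)..θ.hw, ghT θ.k2 j (θ.e2 + θ.hw + z) :=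
    intervalIntegral.integral_sub iA iB
  have d2 : (∫ z in (0:ℝ)..θ.hw, ((((θ.hw - z : ℝ)) : ℂ) * ghT θ.k2 j (θ.e2 + θ.hw + z) + (z : ℂ) * ghT θ.k2 j (θ.e2 + z)))
      = (∫ z in (0:ℝ)..θ.hw, (((θ.hw - z : ℝ)) : ℂ) * ghT θ.k2 j (θ.e2 + θ.hw + z))
        + ∫ z in (0:ℝ)..θ.hw, (z : ℂ) * ghT θ.k2 j (θ.e2 + z) := intervalIntegral.integral_add iC iD
  unfold d5pT d5T d5xT
  rw [d1, d2, θ.g1_eq_L6 h21 h3lo, cx3]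
  have hπ : (π : ℂ) ≠ 0 := by exact_mod_cast Real.pi_ne_zero
  have hν2 : (θ.nu2 : ℂ) ≠ 0 := by exact_mod_cast h2.ne'
  have hν3 : (θ.nu3 : ℂ) ≠ 0 := by exact_mod_cast h3.ne'
  push_cast
  field_simp
  ring

/-! ### `∫₀¹ dipoleIntegrand j g₂ g₂′ f₂ f₂′ = π·(d′₆ⱼ + d₆ⱼ + d₆ᶜⱼ + d₆ˣⱼ)(θ)` on the face -/

/-- **formula I on `(H₂, J̄₂)` is the manuscript's `d′₆ⱼ + d₆ⱼ`** ((10.15) and the display after it, generic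
design on the face `ν₂ = 1/2`, plus the position-of-`ν₃` pieces `d6cT`, `d6xT`, zero in print).
[cite: Zhang2022LandauSiegel, §10 (10.15)–(10.16) p.57] -/
theorem integral_dipoleIntegrand_h2_rtent (h : AdmissibleTheta θ) (hface : θ.nu2 = 1 / 2) (j : ℕ) :
    ∫ y in (0:ℝ)..1, dipoleIntegrand j (h2Profile θ) (h2Profile' θ) (tentT θ.reflectJ) (tentT' θ.reflectJ) y
      = (π : ℂ) * (d6pT θ j + d6T θ j + d6cT θ j + d6xT θ j) := by
  obtain ⟨h3, h32, h21, h1, h3lo, -, hk2, hk3⟩ := h.h2_bounds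
  have h2 : 0 < θ.nu2 := h3.trans h32
  have hr := reflectJ_lt h21
  have hσ := θ.sig_pos h21
  have hp := θ.hw_pos h21
  have hkf := kinkedProfile_tentT hr
  have I2 := intervalIntegrable_dipoleIntegrand (kinkedProfile_kappaP (k := θ.k2) h2 (by linarith)) hkf j
  have I3 := intervalIntegrable_dipoleIntegrand (kinkedProfile_kappaP (k := θ.k3) h3 (by linarith)) hkf j
  have hsplit : ∫ y in (0:ℝ)..1, dipoleIntegrand j (h2Profile θ) (h2Profile' θ) (tentT θ.reflectJ) (tentT' θ.reflectJ) y
      = conj θ.iota4 * (∫ y in (0:ℝ)..1, dipoleIntegrand j (kappaP θ.nu2 θ.k2) (kappaP' θ.nu2 θ.k2)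
          (tentT θ.reflectJ) (tentT' θ.reflectJ) y)
        + conj θ.iota3 * ∫ y in (0:ℝ)..1, dipoleIntegrand j (kappaP θ.nu3 θ.k3) (kappaP' θ.nu3 θ.k3)
          (tentT θ.reflectJ) (tentT' θ.reflectJ) y := by
    rw [← intervalIntegral.integral_const_mul, ← intervalIntegral.integral_const_mul,
      ← intervalIntegral.integral_add (I2.const_mul _) (I3.const_mul _)]
    exact intervalIntegral.integral_congr fun y _ => dip_h2_rtent_split θ j y _ _
  have T3 := integral_dip_kappa_rtent_full (k := θ.k2) h21 h1.le h2 (by linarith) (by linarith) j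
  have T4 := integral_dip_kappa_rtent_part (by linarith) h21 h1.le h3 h3lo (by linarith) j
  have he2 : θ.nu2 - (1 - θ.nu2) = θ.e2 := by unfold Theta.e2; ring
  have hL7 : θ.nu2 - (1 - θ.nu1) = θ.L7 := by unfold Theta.L7; ring
  simp only [he2, hL7] at T3
  rw [hsplit, T3, T4]
  obtain ⟨-, -, cx3, cc0⟩ := θ.clip_eqs h21 h3lo.le (by linarith)
  -- the clipped windows of `d6cT`: the first is empty (`L₆ > 0`), the second is `[0, c₀]`
  have hL6 : 0 < θ.L6 := by unfold Theta.L6; linarith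
  have hc1 : max 0 (-θ.L6) = 0 := max_eq_left (by linarith)
  set c0 := min θ.hw (max 0 (θ.mid2 - θ.nu3)) with hc0
  have hc0le : c0 ≤ θ.hw := min_le_left _ _
  have hc0ge : 0 ≤ c0 := le_min hp.le (le_max_left _ _)
  -- split the combined integrals of the transcription
  have iA : IntervalIntegrable (fun z => conj θ.iota3 * ffT θ.k3 j (θ.L6 + z) / (θ.nu3 : ℂ)) volume 0 (1 - θ.nu1) :=
    Continuous.intervalIntegrable (by fun_prop) _ _
  have iB : IntervalIntegrable (fun z => conj θ.iota4 * ffT θ.k2 j (θ.L7 + z) / (θ.nu2 : ℂ)) volume 0 (1 - θ.nu1) :=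
    Continuous.intervalIntegrable (by fun_prop) _ _
  have d1 : (∫ z in (0:ℝ)..(1 - θ.nu1), (conj θ.iota3 * ffT θ.k3 j (θ.L6 + z) / (θ.nu3 : ℂ)
        + conj θ.iota4 * ffT θ.k2 j (θ.L7 + z) / (θ.nu2 : ℂ)))
      = conj θ.iota3 / (θ.nu3 : ℂ) * (∫ z in (0:ℝ)..(1 - θ.nu1), ffT θ.k3 j (θ.L6 + z))
        + conj θ.iota4 / (θ.nu2 : ℂ) * ∫ z in (0:ℝ)..(1 - θ.nu1), ffT θ.k2 j (θ.L7 + z) := by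
    rw [intervalIntegral.integral_add iA iB, ← intervalIntegral.integral_const_mul,
      ← intervalIntegral.integral_const_mul]
    congr 1 <;> exact intervalIntegral.integral_congr fun z _ => by ring
  have iC : IntervalIntegrable (fun z => ffT θ.k2 j (θ.e2 + z)) volume 0 θ.hw := Continuous.intervalIntegrable (by fun_prop) _ _
  have iD : IntervalIntegrable (fun z => ffT θ.k2 j (θ.e2 + θ.hw + z)) volume 0 θ.hw :=
    Continuous.intervalIntegrable (by fun_prop) _ _
  have d2 : (∫ z in (0:ℝ)..θ.hw, (ffT θ.k2 j (θ.e2 + z) - ffT θ.k2 j (θ.e2 + θ.hw + z)))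
      = (∫ z in (0:ℝ)..θ.hw, ffT θ.k2 j (θ.e2 + z)) - ∫ z in (0:ℝ)..θ.hw, ffT θ.k2 j (θ.e2 + θ.hw + z) :=
    intervalIntegral.integral_sub iC iD
  have iE : IntervalIntegrable (fun z => conj θ.iota3 * ffT θ.k3 j (θ.nu3 - θ.mid2 + z) / (θ.nu3 : ℂ) * yy1rT θ j (θ.mid2 - z))
      volume 0 θ.hw := Continuous.intervalIntegrable (by unfold yy1rT; fun_prop) _ _
  have iF : IntervalIntegrable (fun z => conj θ.iota4 * ffT θ.k2 j (θ.e2 + θ.hw + z) / (θ.nu2 : ℂ) * yy1rT θ j (θ.mid2 - z))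
      volume 0 θ.hw := Continuous.intervalIntegrable (by unfold yy1rT; fun_prop) _ _
  have d3 : (∫ z in (0:ℝ)..θ.hw, (conj θ.iota3 * ffT θ.k3 j (θ.nu3 - θ.mid2 + z) / (θ.nu3 : ℂ)
          + conj θ.iota4 * ffT θ.k2 j (θ.e2 + θ.hw + z) / (θ.nu2 : ℂ)) * yy1rT θ j (θ.mid2 - z))
      = conj θ.iota3 / (θ.nu3 : ℂ) * (∫ z in (0:ℝ)..θ.hw, ffT θ.k3 j (θ.nu3 - θ.mid2 + z) * yy1rT θ j (θ.mid2 - z))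
        + conj θ.iota4 / (θ.nu2 : ℂ) * ∫ z in (0:ℝ)..θ.hw, ffT θ.k2 j (θ.e2 + θ.hw + z) * yy1rT θ j (θ.mid2 - z) := by
    rw [← intervalIntegral.integral_const_mul, ← intervalIntegral.integral_const_mul,
      ← intervalIntegral.integral_add (iE.congr fun z _ => by ring) (iF.congr fun z _ => by ring)]
    exact intervalIntegral.integral_congr fun z _ => by ring
  -- the `ῑ₃` `𝔶𝔶₁ʳ`-window: `∫_{c₀}^{h} = ∫₀^h − ∫₀^{c₀}`
  have iG : ∀ a b : ℝ, IntervalIntegrable (fun z => ffT θ.k3 j (θ.nu3 - θ.mid2 + z) * yy1rT θ j (θ.mid2 - z)) volume a b :=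
    fun a b => Continuous.intervalIntegrable (by unfold yy1rT; fun_prop) _ _
  have d4 : (∫ z in c0..θ.hw, ffT θ.k3 j (θ.nu3 - θ.mid2 + z) * yy1rT θ j (θ.mid2 - z))
      = (∫ z in (0:ℝ)..θ.hw, ffT θ.k3 j (θ.nu3 - θ.mid2 + z) * yy1rT θ j (θ.mid2 - z))
        - ∫ z in (0:ℝ)..c0, ffT θ.k3 j (θ.nu3 - θ.mid2 + z) * yy1rT θ j (θ.mid2 - z) := by
    rw [← intervalIntegral.integral_add_adjacent_intervals (iG 0 c0) (iG c0 θ.hw)]; ring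
  have d5 : (∫ z in (0:ℝ)..c0, conj θ.iota3 * ffT θ.k3 j (θ.nu3 - θ.mid2 + z) / (θ.nu3 : ℂ) * yy1rT θ j (θ.mid2 - z))
      = conj θ.iota3 / (θ.nu3 : ℂ) * ∫ z in (0:ℝ)..c0, ffT θ.k3 j (θ.nu3 - θ.mid2 + z) * yy1rT θ j (θ.mid2 - z) := by
    rw [← intervalIntegral.integral_const_mul]
    exact intervalIntegral.integral_congr fun z _ => by ring
  unfold d6pT d6T d6cT d6xT Theta.nu1pp
  rw [hc1, intervalIntegral.integral_same, ← hc0, d1, d2, d3, d4, d5, θ.g1_eq_L6 h21 h3lo, cx3]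
  have hπ : (π : ℂ) ≠ 0 := by exact_mod_cast Real.pi_ne_zero
  have hν2 : (θ.nu2 : ℂ) ≠ 0 := by exact_mod_cast h2.ne'
  have hν3 : (θ.nu3 : ℂ) ≠ 0 := by exact_mod_cast h3.ne'
  have hσc : (θ.sig : ℂ) ≠ 0 := by exact_mod_cast hσ.ne'
  rw [θ.hw_eq_inv_sig h21]
  push_cast
  field_simp
  ring

/-! ### The `𝔡′`-block and the whole cross term are the transcribed §10 functionals on the face -/

/-- **K-S3 faithfulness, `H₂`-blocks**: on the face `ν₂ = 1/2` of the class,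
`dSum2S θ = Σ_j W_j (d′₅ⱼ + d₅ⱼ + d₅ˣⱼ + conj(d′₆ⱼ + d₆ⱼ + d₆ᶜⱼ + d₆ˣⱼ))(θ)`.
[cite: Zhang2022LandauSiegel, §10 (10.1), (10.14)–(10.17)] -/
theorem dSum2S_eq_section10 (h : AdmissibleTheta θ) (hface : θ.nu2 = 1 / 2) :
    dSum2S θ = 1 / 2 * (d5pT θ 1 + d5T θ 1 + d5xT θ 1 + conj (d6pT θ 1 + d6T θ 1 + d6cT θ 1 + d6xT θ 1))
      + 2 * (d5pT θ 2 + d5T θ 2 + d5xT θ 2 + conj (d6pT θ 2 + d6T θ 2 + d6cT θ 2 + d6xT θ 2))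
      + 3 / 2 * (d5pT θ 3 + d5T θ 3 + d5xT θ 3 + conj (d6pT θ 3 + d6T θ 3 + d6cT θ 3 + d6xT θ 3)) := by
  unfold dSum2S Mform
  rw [integral_dipoleIntegrand_rtent_h2 h hface 1, integral_dipoleIntegrand_rtent_h2 h hface 2,
    integral_dipoleIntegrand_rtent_h2 h hface 3, integral_dipoleIntegrand_h2_rtent h hface 1,
    integral_dipoleIntegrand_h2_rtent h hface 2, integral_dipoleIntegrand_h2_rtent h hface 3]
  have hπ : (π : ℂ) ≠ 0 := by exact_mod_cast Real.pi_ne_zero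
  simp only [map_add, map_mul, map_div₀, Complex.conj_ofReal, map_ofNat, map_one]
  push_cast
  field_simp
  ring

/-- **K-S3 faithfulness: the cross main term of record IS the transcribed `𝔡′(θ) + 𝔡(θ)`** of (10.17)
(`RepairSection10Theta.dprimeT`, `dfrakT`) for every admissible design on the face `ν₂ = 1/2`.
[cite: Zhang2022LandauSiegel, §10 (10.17) p.57] -/
theorem dSumS_eq_section10 (h : AdmissibleTheta θ) (hface : θ.nu2 = 1 / 2) :
    dSumS θ = dprimeT θ + dfrakT θ := by
  unfold dSumS dprimeT dfrakT dfrakJT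
  rw [dSum1S_eq_section10 h, dSum2S_eq_section10 h hface]
  simp only [map_add]
  ring

/-- hence on the face the polar form on the glued profile is the transcribed `𝔡′ + 𝔡`:
`dprimeT θ + dfrakT θ = P(g₁ + R̃g₂, f)`. [cite: Zhang2022LandauSiegel, §10 (10.17) p.57; §2 (2.18)] -/
theorem dprimeT_add_dfrakT_eq_polar (h : AdmissibleTheta θ) (hface : θ.nu2 = 1 / 2) :
    dprimeT θ + dfrakT θ = mainTermFormPolar (fun y => h1Profile θ y + reflProfile (h2Profile θ) y)
      (fun y => h1Profile' θ y + reflDeriv (h2Profile' θ) y) (tentT θ) (tentT' θ) := by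
  rw [← dSumS_eq_section10 h hface, dSumS_eq_polar h]

/-- **Regression at the printed design**: `dSumS θ₀ = 𝔡′ + 𝔡` (the tree's literal §10 constants, certified in
`Section10Certificate`: `|𝔡′+𝔡|² ∈ (28.0792, 28.0795)`). [cite: Zhang2022LandauSiegel, §10 (10.12)–(10.17) p.55–57] -/
theorem dSumS_theta0 : dSumS theta0 = dprime + dfrak := by
  rw [dSumS_eq_section10 admissible_theta0 (by norm_num [theta0]), dprimeT_theta0, dfrakT_theta0]

end Repair

end Literature.NumberTheory.LFunctions.Zhang2022
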